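import Mathlib
import Summits.NavierStokesRegularity.NavierStokesRegularity.Theorems.EulerZoomLiouvillePowerGaugeEulerLiouvilleSelfSimilarNoDriftLoc
import Summits.NavierStokesRegularity.NavierStokesRegularity.Theorems.EulerZoomLiouvillePowerGaugeEulerLiouvilleSelfSimilarNoDriftBadNodeC2
import Literature.LinearAlgebra.BorderedKernelInvertible
import HarnessLib.Audit

/-!
# Rung C1 of the crux `EulerZoomLiouville.PowerGaugeEulerLiouville` (W3a step L3): no drift at a BAD limit node, PROFILE-FREE — the node's
# incompressibility and vorticity eigen-relation as pointwise hypotheses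

Route №10 `EulerZoomLiouville` (NavierStokesRegularity), crux E = stmt-NavierStokesRegularity-19832, tenure rung C1,
registered residue `stub_selfSimilarExtremalRest`, sub-stratum W3a (programme HOME/ns-typeII-p2/W3a-PLAN-19832.md).  Lineage
ns-typeII-p2 (gen 8, INTERIM LEAD).  Profile-free twins of `C2.NoDrift.tendsto_flow_atBot_of_{nonvortical_badClusterPt,
vortical_clusterPt,badClusterPt}'` (p582973): the flow is that of any `C²` field `γy + V` with `‖V‖ ≤ M`, `‖DV‖ ≤ K`; the
profile equation enters only through the POINT hypotheses (`W(Φ_s x) → 0`, finite speed budget) and the NODE hypotheses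
(`tr DV(z₀) = 0`, and at a vortical node `DV(z₀)Ω(z₀) = Ω(z₀)`), which the assembly supplies from the true profile on the ball
where the cut-off field agrees with it.  WHAT THIS IS NOT: not NS, not E, not rung C1. [folklore]
-/

noncomputable section

-- flat `Theorems/<Route><Decl>…` files of one crux share the namespace of the crux (tree convention)
set_option linter.dupNamespace false

open MeasureTheory Set Filter Topology Metric Function InnerProductSpace
open scoped RealInnerProductSpace NNReal ContDiff

namespace Summit.NavierStokesRegularity.NavierStokesRegularity.Theorems.PowerGaugeEulerLiouville.Loc

open Literature.Analysis Literature.Analysis.FluidPDE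
open Summit.NavierStokesRegularity.NavierStokesRegularity.Theorems.PowerGaugeEulerLiouville.C2.Kelvin
open Summit.NavierStokesRegularity.NavierStokesRegularity.Theorems.PowerGaugeEulerLiouville.NoDrift

variable {γ : ℝ} {V : EuclideanSpace ℝ (Fin 3) → EuclideanSpace ℝ (Fin 3)}

/-- **NO DRIFT AT A NON-VORTICAL BAD LIMIT NODE — profile-free form.**  `V ∈ C²`, `‖V‖ ≤ M`, `‖DV‖ ≤ K`, `0 < γ < ½`, NO
profile equation; point hypotheses `W(Φ_s x) → 0`, `∫₀^∞‖W(Φ₋ₜx)‖² < ∞`; node hypothesis `tr DV(z₀) = 0` in place of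
incompressibility.  If the backward limit point `z₀` is non-vortical and bad, the orbit converges. [folklore] -/
theorem tendsto_flow_atBot_of_nonvortical_badClusterPt_loc (hV : ContDiff ℝ 2 V) {K : ℝ}
    (hK : ∀ y, ‖fderiv ℝ V y‖ ≤ K) {M : ℝ} (hM : ∀ y, ‖V y‖ ≤ M)
    (hγ : 0 < γ) (hγ2 : γ < 1 / 2) (x : EuclideanSpace ℝ (Fin 3))
    (htends : Tendsto (fun s => selfSimilarTransport γ 0 V
      (ODE.evolutionMap (fun _ : ℝ => selfSimilarTransport γ 0 V) 0 s x)) atBot (𝓝 0))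
    (hint : IntegrableOn (fun t : ℝ => ‖selfSimilarTransport γ 0 V
      (ODE.evolutionMap (fun _ : ℝ => selfSimilarTransport γ 0 V) 0 (-t) x)‖ ^ 2) (Ioi 0))
    {z₀ : EuclideanSpace ℝ (Fin 3)}
    (hz₀ : MapClusterPt z₀ atBot fun s => ODE.evolutionMap (fun _ : ℝ => selfSimilarTransport γ 0 V) 0 s x)
    (hdiv0 : LinearMap.trace ℝ _ ((fderiv ℝ V z₀ : EuclideanSpace ℝ (Fin 3) →L[ℝ] EuclideanSpace ℝ (Fin 3)) :
      EuclideanSpace ℝ (Fin 3) →ₗ[ℝ] EuclideanSpace ℝ (Fin 3)) = 0)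
    (hΩ : curl V z₀ = 0) {w : EuclideanSpace ℝ (Fin 3)} (hw : ‖w‖ = 1) (hbad : 1 ≤ ⟪fderiv ℝ V z₀ w, w⟫) :
    ∃ z ∈ selfSimilarNodalSet γ 0 V,
      Tendsto (fun s => ODE.evolutionMap (fun _ : ℝ => selfSimilarTransport γ 0 V) 0 s x) atBot (𝓝 z) := by
  have hV1 : ContDiff ℝ 1 V := hV.of_le (by norm_num)
  set W := selfSimilarTransport γ 0 V with hWdef
  set Φ := ODE.evolutionMap (fun _ : ℝ => W) 0 with hΦdef
  have hVd : Differentiable ℝ V := hV.differentiable (by norm_num)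
  -- compact tail, continuity, limit points are nodes
  set B : ℝ := ‖x‖ + M / γ with hB
  have hKc : IsCompact (closedBall (0 : EuclideanSpace ℝ (Fin 3)) B) := isCompact_closedBall 0 B
  have htail : ∀ᶠ s in atBot, Φ s x ∈ closedBall (0 : EuclideanSpace ℝ (Fin 3)) B := by
    filter_upwards [eventually_le_atBot (0 : ℝ)] with s hs
    rw [mem_closedBall, dist_zero_right, hB]
    exact norm_flow_le_of_nonpos' hV1 hK hM hγ x hs
  have hcont : Continuous fun s => Φ s x := continuous_flow_apply (γ := γ) hV1 hK x
  have hN : ∀ z, MapClusterPt z atBot (fun s => Φ s x) → z ∈ selfSimilarNodalSet γ 0 V :=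
    fun z hz => mem_nodalSet_of_mapClusterPt_atBot_of_tendsto hV1 htends hz
  have hz₀N : W z₀ = 0 := hN z₀ hz₀
  by_cases hiso : ∃ r : ℝ, 0 < r ∧ ∀ y ∈ selfSimilarNodalSet γ 0 V, dist y z₀ < r → y = z₀
  · obtain ⟨r, hr, hiso⟩ := hiso
    exact ⟨z₀, hN z₀ hz₀, tendsto_of_isolated_mapClusterPt hcont hKc htail hN hz₀ hr hiso⟩
  -- non-isolated: a unit kernel vector of `DW(z₀)`
  push Not at hiso
  have hDV : fderiv ℝ W z₀ = γ • ContinuousLinearMap.id ℝ _ + fderiv ℝ V z₀ :=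
    (hasFDerivAt_selfSimilarTransport (γ := γ) (c := 0) hVd z₀).fderiv
  have hWd : HasFDerivAt W (fderiv ℝ W z₀) z₀ := by
    rw [hDV]; exact hasFDerivAt_selfSimilarTransport (γ := γ) (c := 0) hVd z₀
  obtain ⟨e, he, hLe⟩ := exists_unit_kernel_of_accumulating_zeros hWd hz₀N fun r hr => by
    obtain ⟨y, hy, hdist, hne⟩ := hiso r hr
    exact ⟨y, hne, hdist, hy⟩
  -- `DW(z₀)` is symmetric with trace `3γ` and `⟪DW w, w⟫ ≥ 1 + γ`
  have hS := isSymmetric_fderiv_of_curl_eq_zero (hVd z₀) hΩ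
  have hLsym : ((fderiv ℝ W z₀ : EuclideanSpace ℝ (Fin 3) →L[ℝ] EuclideanSpace ℝ (Fin 3)) :
      EuclideanSpace ℝ (Fin 3) →ₗ[ℝ] EuclideanSpace ℝ (Fin 3)).IsSymmetric := by
    rw [hDV]
    intro u v
    have hSuv := hS u v
    simp only [ContinuousLinearMap.coe_coe] at hSuv
    simp only [ContinuousLinearMap.coe_coe, add_apply, FunLike.coe_smul, Pi.smul_apply,
      ContinuousLinearMap.id_apply, inner_add_left, inner_add_right, real_inner_smul_left, real_inner_smul_right]
    rw [hSuv]
  have htr : LinearMap.trace ℝ _ ((fderiv ℝ W z₀ : EuclideanSpace ℝ (Fin 3) →L[ℝ] EuclideanSpace ℝ (Fin 3)) :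
      EuclideanSpace ℝ (Fin 3) →ₗ[ℝ] EuclideanSpace ℝ (Fin 3)) = 3 * γ := by
    have hdiv : LinearMap.trace ℝ _ ((fderiv ℝ V z₀ : EuclideanSpace ℝ (Fin 3) →L[ℝ] EuclideanSpace ℝ (Fin 3)) :
        EuclideanSpace ℝ (Fin 3) →ₗ[ℝ] EuclideanSpace ℝ (Fin 3)) = 0 := hdiv0
    rw [hDV, ContinuousLinearMap.toLinearMap_add, ContinuousLinearMap.toLinearMap_smul, map_add,
      map_smul, hdiv, ContinuousLinearMap.coe_id, LinearMap.trace_id, finrank_euclideanSpace,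
      Fintype.card_fin]
    norm_num [smul_eq_mul]
    ring
  have hbadW : 1 + γ ≤ ⟪fderiv ℝ W z₀ w, w⟫ := by
    rw [hDV]
    simp only [add_apply, FunLike.coe_smul, Pi.smul_apply, ContinuousLinearMap.id_apply,
      inner_add_left, real_inner_smul_left, real_inner_self_eq_norm_sq, hw]
    linarith
  have hker := ker_inter_orth_eq_zero_of_bad hLsym hγ.le hγ2 htr hw hbadW he hLe
  obtain ⟨T, hT⟩ := exists_borderedEquiv_of_isSymmetric hLsym he hLe hker
  exact tendsto_flow_atBot_of_bordered_clusterPt_loc hV hK hM hγ x htends hint hz₀ he hLe T hT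

/-- **NO DRIFT AT A VORTICAL LIMIT NODE — profile-free form.**  Same setting; node hypotheses `tr DV(z₀) = 0` and the
vorticity eigen-relation `DV(z₀) Ω(z₀) = Ω(z₀)` (the pointwise content of CIV's `DU Ω = Ω at a node`) in place of the profile
equation. [folklore] -/
theorem tendsto_flow_atBot_of_vortical_clusterPt_loc (hV : ContDiff ℝ 2 V) {K : ℝ}
    (hK : ∀ y, ‖fderiv ℝ V y‖ ≤ K) {M : ℝ} (hM : ∀ y, ‖V y‖ ≤ M)
    (hγ : 0 < γ) (hγ2 : γ < 1 / 2) (x : EuclideanSpace ℝ (Fin 3))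
    (htends : Tendsto (fun s => selfSimilarTransport γ 0 V
      (ODE.evolutionMap (fun _ : ℝ => selfSimilarTransport γ 0 V) 0 s x)) atBot (𝓝 0))
    (hint : IntegrableOn (fun t : ℝ => ‖selfSimilarTransport γ 0 V
      (ODE.evolutionMap (fun _ : ℝ => selfSimilarTransport γ 0 V) 0 (-t) x)‖ ^ 2) (Ioi 0))
    {z₀ : EuclideanSpace ℝ (Fin 3)}
    (hz₀ : MapClusterPt z₀ atBot fun s => ODE.evolutionMap (fun _ : ℝ => selfSimilarTransport γ 0 V) 0 s x)
    (hdiv0 : LinearMap.trace ℝ _ ((fderiv ℝ V z₀ : EuclideanSpace ℝ (Fin 3) →L[ℝ] EuclideanSpace ℝ (Fin 3)) :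
      EuclideanSpace ℝ (Fin 3) →ₗ[ℝ] EuclideanSpace ℝ (Fin 3)) = 0)
    (heig : fderiv ℝ V z₀ (curl V z₀) = curl V z₀)
    (hΩ : curl V z₀ ≠ 0) :
    ∃ z ∈ selfSimilarNodalSet γ 0 V,
      Tendsto (fun s => ODE.evolutionMap (fun _ : ℝ => selfSimilarTransport γ 0 V) 0 s x) atBot (𝓝 z) := by
  have hV1 : ContDiff ℝ 1 V := hV.of_le (by norm_num)
  set W := selfSimilarTransport γ 0 V with hWdef
  set Φ := ODE.evolutionMap (fun _ : ℝ => W) 0 with hΦdef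
  have hVd : Differentiable ℝ V := hV.differentiable (by norm_num)
  set B : ℝ := ‖x‖ + M / γ with hB
  have hKc : IsCompact (closedBall (0 : EuclideanSpace ℝ (Fin 3)) B) := isCompact_closedBall 0 B
  have htail : ∀ᶠ s in atBot, Φ s x ∈ closedBall (0 : EuclideanSpace ℝ (Fin 3)) B := by
    filter_upwards [eventually_le_atBot (0 : ℝ)] with s hs
    rw [mem_closedBall, dist_zero_right, hB]
    exact norm_flow_le_of_nonpos' hV1 hK hM hγ x hs
  have hcont : Continuous fun s => Φ s x := continuous_flow_apply (γ := γ) hV1 hK x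
  have hN : ∀ z, MapClusterPt z atBot (fun s => Φ s x) → z ∈ selfSimilarNodalSet γ 0 V :=
    fun z hz => mem_nodalSet_of_mapClusterPt_atBot_of_tendsto hV1 htends hz
  have hz₀N : z₀ ∈ selfSimilarNodalSet γ 0 V := hN z₀ hz₀
  by_cases hiso : ∃ r : ℝ, 0 < r ∧ ∀ y ∈ selfSimilarNodalSet γ 0 V, dist y z₀ < r → y = z₀
  · obtain ⟨r, hr, hiso⟩ := hiso
    exact ⟨z₀, hz₀N, tendsto_of_isolated_mapClusterPt hcont hKc htail hN hz₀ hr hiso⟩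
  push Not at hiso
  have hDV : fderiv ℝ W z₀ = γ • ContinuousLinearMap.id ℝ _ + fderiv ℝ V z₀ :=
    (hasFDerivAt_selfSimilarTransport (γ := γ) (c := 0) hVd z₀).fderiv
  have hWd : HasFDerivAt W (fderiv ℝ W z₀) z₀ := by
    rw [hDV]; exact hasFDerivAt_selfSimilarTransport (γ := γ) (c := 0) hVd z₀
  obtain ⟨e, he, hLe⟩ := exists_unit_kernel_of_accumulating_zeros hWd hz₀N fun r hr => by
    obtain ⟨y, hy, hdist, hne⟩ := hiso r hr
    exact ⟨y, hne, hdist, hy⟩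
  -- the vorticity is an eigenvector with eigenvalue `1 + γ`
  have hAω : fderiv ℝ W z₀ (curl V z₀) = (1 + γ) • curl V z₀ := by
    rw [hDV, add_apply, FunLike.coe_smul, Pi.smul_apply, ContinuousLinearMap.id_apply,
      heig, add_smul, one_smul,
      add_comm]
  have htr : LinearMap.trace ℝ _ ((fderiv ℝ W z₀ : EuclideanSpace ℝ (Fin 3) →L[ℝ] EuclideanSpace ℝ (Fin 3)) :
      EuclideanSpace ℝ (Fin 3) →ₗ[ℝ] EuclideanSpace ℝ (Fin 3)) = 3 * γ := by
    have hdiv : LinearMap.trace ℝ _ ((fderiv ℝ V z₀ : EuclideanSpace ℝ (Fin 3) →L[ℝ] EuclideanSpace ℝ (Fin 3)) :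
        EuclideanSpace ℝ (Fin 3) →ₗ[ℝ] EuclideanSpace ℝ (Fin 3)) = 0 := hdiv0
    rw [hDV, ContinuousLinearMap.toLinearMap_add, ContinuousLinearMap.toLinearMap_smul, map_add,
      map_smul, hdiv, ContinuousLinearMap.coe_id, LinearMap.trace_id, finrank_euclideanSpace,
      Fintype.card_fin]
    norm_num [smul_eq_mul]
    ring
  obtain ⟨T, hT⟩ := Literature.LinearAlgebra.exists_borderedEquiv_of_vortical_node finrank_euclideanSpace_fin
    (fderiv ℝ W z₀) hΩ hAω he hLe htr (ne_of_lt hγ2) (by intro h; linarith)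
  exact tendsto_flow_atBot_of_bordered_clusterPt_loc hV hK hM hγ x htends hint hz₀ he hLe T hT

/-- **NO DRIFT AT A BAD LIMIT NODE** (vortical or not) — profile-free form. [folklore] -/
theorem tendsto_flow_atBot_of_badClusterPt_loc (hV : ContDiff ℝ 2 V) {K : ℝ}
    (hK : ∀ y, ‖fderiv ℝ V y‖ ≤ K) {M : ℝ} (hM : ∀ y, ‖V y‖ ≤ M)
    (hγ : 0 < γ) (hγ2 : γ < 1 / 2) (x : EuclideanSpace ℝ (Fin 3))
    (htends : Tendsto (fun s => selfSimilarTransport γ 0 V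
      (ODE.evolutionMap (fun _ : ℝ => selfSimilarTransport γ 0 V) 0 s x)) atBot (𝓝 0))
    (hint : IntegrableOn (fun t : ℝ => ‖selfSimilarTransport γ 0 V
      (ODE.evolutionMap (fun _ : ℝ => selfSimilarTransport γ 0 V) 0 (-t) x)‖ ^ 2) (Ioi 0))
    {z₀ : EuclideanSpace ℝ (Fin 3)}
    (hz₀ : MapClusterPt z₀ atBot fun s => ODE.evolutionMap (fun _ : ℝ => selfSimilarTransport γ 0 V) 0 s x)
    (hdiv0 : LinearMap.trace ℝ _ ((fderiv ℝ V z₀ : EuclideanSpace ℝ (Fin 3) →L[ℝ] EuclideanSpace ℝ (Fin 3)) :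
      EuclideanSpace ℝ (Fin 3) →ₗ[ℝ] EuclideanSpace ℝ (Fin 3)) = 0)
    (heig : curl V z₀ ≠ 0 → fderiv ℝ V z₀ (curl V z₀) = curl V z₀)
    {w : EuclideanSpace ℝ (Fin 3)} (hw : ‖w‖ = 1) (hbad : 1 ≤ ⟪fderiv ℝ V z₀ w, w⟫) :
    ∃ z ∈ selfSimilarNodalSet γ 0 V,
      Tendsto (fun s => ODE.evolutionMap (fun _ : ℝ => selfSimilarTransport γ 0 V) 0 s x) atBot (𝓝 z) := by
  by_cases hΩ : curl V z₀ = 0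
  · exact tendsto_flow_atBot_of_nonvortical_badClusterPt_loc hV hK hM hγ hγ2 x htends hint hz₀ hdiv0 hΩ hw hbad
  · exact tendsto_flow_atBot_of_vortical_clusterPt_loc hV hK hM hγ hγ2 x htends hint hz₀ hdiv0 (heig hΩ) hΩ

end Summit.NavierStokesRegularity.NavierStokesRegularity.Theorems.PowerGaugeEulerLiouville.Loc

end
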